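import Mathlib
import Literature.NumberTheory.Sieve.PolynomialCongruencesRootCount
import Literature.NumberTheory.Sieve.PolynomialCongruencesRootDensity
import Literature.NumberTheory.Sieve.AletheiaZomleferFukshanskyGarcia2020ApplicationsBrunSieveProofs
import Literature.NumberTheory.LFunctions.MertensElementary
import Summits.Parity.BatemanHorn.Theorems.AlmostPrimeZerosExtractionAtZeroAux
import HarnessLib

/-!
# Nair–Tenenbaum light, XI: the product polynomial of a Bateman–Horn system and the capped weights

Crux `SystemLSDRealSegment` (stmt-Parity-11292), line `beta-thinned-root-kernel`, support programme of the lead c8.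
The inputs that feed `nairTenenbaumLight` (file `…NairMain`) for `F = ∏ᵢ fᵢ`, `f` a Bateman–Horn system, and for the
weight `G(m) = y^{Σ_{p^v ∥ m} min(v, K)}`:
* `ρ_f(m) = ρ_F(m)` (the family count is the count of the product), the union bound `ρ_F(p) ≤ Σᵢ ρ_{fᵢ}(p) ≤ Σᵢ deg fᵢ`,
  `ρ_F(p) < p`, and shift invariance `ρ_{F(X+a)}(m) = ρ_F(m)`;
* `F` is separable over `ℚ` (pairwise non-associated irreducible members), whence `F·A + F′·B = R ≠ 0` and the uniform
  prime-power bound `ρ_F(p^a) ≤ (deg F)·M` (Nagell/Hensel, the tree's `polyRootCountMod_prime_pow_le_of_resultant`);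
* Mertens from above along the system: `Σ_{p ≤ x} ρ_f(p)/p ≤ k log log x + C`
  (`AZFG2020_tendsto_sum_sub_omega_div_holds` + `MertensBound.sum_inv_prime_le`);
* the `K`-capped statistic is additive on coprime arguments, `= min(v,K)` at `p^v`, and dominates the crux's statistic:
  `Σᵢ s(mᵢ) ≤ s_{2k}(∏ᵢ mᵢ)` (`s = ` cap `2`, `s_{2k} = ` cap `2k`) — no bad-prime analysis is needed.
Everything is PROVED; no definitions.
-/

open Finset Real Polynomial Filter

namespace Summit.Parity.BatemanHorn.Cruxes.SystemLSDRealSegment.BetaThinnedRootKernel.Nair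

open Literature.NumberTheory.Sieve

noncomputable section

/-! ### Root counts of the product polynomial -/

/-- Union bound at a prime: `ρ_{∏ fᵢ}(p) ≤ Σᵢ ρ_{fᵢ}(p)`. [folklore] -/
theorem polyRootCountMod_prod_le_sum {k : ℕ} (f : Fin k → ℤ[X]) {p : ℕ} (hp : p.Prime) :
    polyRootCountMod ![∏ i, f i] p ≤ ∑ i, polyRootCountMod ![f i] p := by
  classical
  rw [← PolyPrimeCountBrun.polyRootCountMod_eq_single_prod]
  have hset : (range p).filter (fun n : ℕ => (p : ℤ) ∣ ∏ i, (f i).eval (n : ℤ)) =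
      (univ : Finset (Fin k)).biUnion fun i => (range p).filter fun n : ℕ => (p : ℤ) ∣ (f i).eval (n : ℤ) := by
    ext n
    simp only [mem_filter, mem_biUnion, mem_univ, true_and]
    rw [(Nat.prime_iff_prime_int.mp hp).dvd_finsetProd_iff]
    simp
  simp only [polyRootCountMod_single]
  unfold polyRootCountMod
  rw [hset]
  exact card_biUnion_le

/-- **Shift invariance**: `ρ_{F(X + a)}(m) = ρ_F(m)` (`x ↦ x + a` permutes `ℤ/m`). [folklore] -/
theorem polyRootCountMod_comp_X_add (F : ℤ[X]) (a : ℕ) (m : ℕ) :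
    polyRootCountMod ![F.comp (X + C (a : ℤ))] m = polyRootCountMod ![F] m := by
  classical
  rcases Nat.eq_zero_or_pos m with rfl | hm
  · simp [polyRootCountMod_single]
  haveI : NeZero m := ⟨hm.ne'⟩
  rw [polyRootCountMod_single_eq_card_zmod, polyRootCountMod_single_eq_card_zmod]
  set φ := Int.castRingHom (ZMod m)
  have hev : ∀ x : ZMod m, ((F.comp (X + C (a : ℤ))).map φ).eval x = (F.map φ).eval (x + a) := by
    intro x
    rw [Polynomial.map_comp, eval_comp, Polynomial.map_add, map_X, map_C, eval_add, eval_X, eval_C, eq_intCast,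
      Int.cast_natCast]
  refine Finset.card_nbij' (fun x : ZMod m => x + a) (fun z : ZMod m => z - a) ?_ ?_ ?_ ?_
  · intro x hx
    simp only [mem_coe, mem_filter, mem_univ, true_and] at hx ⊢
    rwa [hev] at hx
  · intro z hz
    simp only [mem_coe, mem_filter, mem_univ, true_and] at hz ⊢
    rw [hev, sub_add_cancel]; exact hz
  · intro x _; simp
  · intro z _; simp

/-- Values of the shifted polynomial. [folklore] -/
theorem eval_comp_X_add (F : ℤ[X]) (a : ℕ) (n : ℕ) :
    (F.comp (X + C (a : ℤ))).eval (n : ℤ) = F.eval ((n + a : ℕ) : ℤ) := by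
  rw [eval_comp, eval_add, eval_X, eval_C]; push_cast; ring_nf

/-- Degree of the shifted polynomial. [folklore] -/
theorem natDegree_comp_X_add (F : ℤ[X]) (a : ℕ) : (F.comp (X + C (a : ℤ))).natDegree = F.natDegree := by
  rw [natDegree_comp, natDegree_X_add_C, mul_one]

section System

variable {k : ℕ} {f : Fin k → ℤ[X]}

/-- Degree of the product: `deg ∏ fᵢ = Σ deg fᵢ`. [folklore] -/
theorem natDegree_prod_eq (hf : IsBatemanHornSystem f) : (∏ i, f i).natDegree = ∑ i, (f i).natDegree :=
  natDegree_prod _ _ fun i _ => (hf.irreducible i).ne_zero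

/-- `ρ_F(p) ≤ Σ deg fᵢ` for every prime `p`. [folklore] -/
theorem rootCount_prod_le_totalDegree (hf : IsBatemanHornSystem f) {p : ℕ} (hp : p.Prime) :
    polyRootCountMod ![∏ i, f i] p ≤ ∑ i, (f i).natDegree :=
  (polyRootCountMod_prod_le_sum f hp).trans
    (Finset.sum_le_sum fun i _ =>
      polyRootCountMod_prime_le_natDegree_of_irreducible (hf.irreducible i) (hf.natDegree_pos i) hp)

/-- `ρ_F(p) < p` for every prime `p` (no fixed prime divisor). [folklore] -/
theorem rootCount_prod_lt (hf : IsBatemanHornSystem f) {p : ℕ} (hp : p.Prime) :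
    polyRootCountMod ![∏ i, f i] p < p := by
  rw [← PolyPrimeCountBrun.polyRootCountMod_eq_single_prod]; exact hf.hasNoFixedPrimeDivisor p hp

/-- **The product is separable over `ℚ`.** [folklore] -/
theorem separable_map_prod (hf : IsBatemanHornSystem f) :
    ((∏ i, f i).map (Int.castRingHom ℚ)).Separable := by
  set φ := Int.castRingHom ℚ
  rw [Polynomial.map_prod]
  refine separable_prod (fun i j hij => ?_) fun i => ?_
  · -- coprime from `fᵢ a + fⱼ b = c ≠ 0`
    obtain ⟨a, b, c, hc, habc⟩ := exists_mul_add_mul_eq_C_of_not_associated (hf.irreducible i) (hf.irreducible j)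
      (hf.pairwise_not_associated hij)
    have h1 : (f i).map φ * (a.map φ * C (c : ℚ)⁻¹) + (f j).map φ * (b.map φ * C (c : ℚ)⁻¹) = 1 := by
      have h2 := congrArg (Polynomial.map φ) habc
      rw [Polynomial.map_add, Polynomial.map_mul, Polynomial.map_mul, map_C, eq_intCast] at h2
      have hc' : (c : ℚ) ≠ 0 := by exact_mod_cast hc
      calc (f i).map φ * (a.map φ * C (c : ℚ)⁻¹) + (f j).map φ * (b.map φ * C (c : ℚ)⁻¹)
          = ((f i).map φ * a.map φ + (f j).map φ * b.map φ) * C (c : ℚ)⁻¹ := by ring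
        _ = C (c : ℚ) * C (c : ℚ)⁻¹ := by rw [h2]
        _ = 1 := by rw [← C_mul, mul_inv_cancel₀ hc', C_1]
    exact ⟨a.map φ * C (c : ℚ)⁻¹, b.map φ * C (c : ℚ)⁻¹, by rw [mul_comm (a.map φ * _), mul_comm (b.map φ * _)]; exact h1⟩
  · have hprim : (f i).IsPrimitive := (hf.irreducible i).isPrimitive (hf.natDegree_pos i).ne'
    have hQ : Irreducible ((f i).map φ) := (IsPrimitive.Int.irreducible_iff_irreducible_map_cast hprim).mp (hf.irreducible i)
    exact hQ.separable

/-- **The resultant identity for the product**: `F A + F′ B = R` with an integer `R ≠ 0` (needs `k ≥ 1`). [folklore] -/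
theorem exists_mul_add_derivative_mul_eq_C_prod (hf : IsBatemanHornSystem f) (hk : 1 ≤ k) :
    ∃ (A B : ℤ[X]) (R : ℤ), R ≠ 0 ∧ (∏ i, f i) * A + derivative (∏ i, f i) * B = C R := by
  set F := ∏ i, f i with hF
  have hdeg : 0 < F.natDegree := by
    rw [hF, natDegree_prod_eq hf]
    obtain ⟨i⟩ : Nonempty (Fin k) := ⟨⟨0, hk⟩⟩
    exact Finset.sum_pos' (fun j _ => Nat.zero_le _) ⟨i, mem_univ _, hf.natDegree_pos i⟩
  obtain ⟨A, B, -, -, hAB⟩ := exists_mul_add_mul_eq_C_resultant F (derivative F) (le_refl _)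
    (natDegree_derivative_le F) (Or.inl hdeg.ne')
  refine ⟨A, B, F.resultant (derivative F) F.natDegree (F.natDegree - 1), ?_, hAB⟩
  intro hR
  set φ := Int.castRingHom ℚ
  have hsepQ : (F.map φ).Separable := separable_map_prod hf
  have e1 : (F.map φ).natDegree = F.natDegree := natDegree_map_eq_of_injective φ.injective_int F
  have e2 : (derivative (F.map φ)).natDegree = F.natDegree - 1 := by
    rw [derivative_map, natDegree_map_eq_of_injective φ.injective_int, natDegree_derivative]
  have hresQ : resultant (F.map φ) (derivative (F.map φ)) (F.map φ).natDegree
      (derivative (F.map φ)).natDegree = 0 := by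
    rw [e1, e2, derivative_map, resultant_map_map, hR, map_zero]
  obtain ⟨-, hnc⟩ := resultant_eq_zero_iff.mp hresQ
  exact hnc hsepQ

/-- **Uniform prime-power bound for the product**: `ρ_F(p^a) ≤ (deg F)·M` for all primes `p`, all `a`. [folklore] -/
theorem exists_rootCount_prod_prime_pow_le (hf : IsBatemanHornSystem f) (hk : 1 ≤ k) :
    ∃ M : ℕ, 1 ≤ M ∧ ∀ p : ℕ, p.Prime → ∀ a : ℕ, polyRootCountMod ![∏ i, f i] (p ^ a) ≤ (∏ i, f i).natDegree * M := by
  set F := ∏ i, f i with hF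
  have hdeg : 0 < F.natDegree := by
    rw [hF, natDegree_prod_eq hf]
    obtain ⟨i⟩ : Nonempty (Fin k) := ⟨⟨0, hk⟩⟩
    exact Finset.sum_pos' (fun j _ => Nat.zero_le _) ⟨i, mem_univ _, hf.natDegree_pos i⟩
  obtain ⟨A, B, R, hR, hAB⟩ := exists_mul_add_derivative_mul_eq_C_prod hf hk
  have hR1 : 1 ≤ R.natAbs := Nat.one_le_iff_ne_zero.2 (Int.natAbs_ne_zero.2 hR)
  refine ⟨R.natAbs ^ 2, Nat.one_le_pow _ _ hR1, fun p hp a => ?_⟩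
  haveI := Fact.mk hp
  set δ := padicValInt p R with hδ
  have hpδ : p ^ δ ≤ R.natAbs := Nat.le_of_dvd (Nat.pos_of_ne_zero (Int.natAbs_ne_zero.2 hR)) pow_padicValNat_dvd
  rcases lt_or_ge a (2 * δ + 1) with ha | ha
  · calc polyRootCountMod ![F] (p ^ a) ≤ p ^ a := polyRootCountMod_le _ _
      _ ≤ p ^ (2 * δ) := Nat.pow_le_pow_right hp.pos (by omega)
      _ = (p ^ δ) ^ 2 := by rw [← pow_mul, mul_comm]
      _ ≤ R.natAbs ^ 2 := Nat.pow_le_pow_left hpδ 2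
      _ ≤ F.natDegree * R.natAbs ^ 2 := Nat.le_mul_of_pos_left _ hdeg
  · calc polyRootCountMod ![F] (p ^ a) ≤ F.natDegree * p ^ δ := polyRootCountMod_prime_pow_le_of_resultant hR hAB ha
      _ ≤ F.natDegree * R.natAbs := Nat.mul_le_mul_left _ hpδ
      _ ≤ F.natDegree * R.natAbs ^ 2 := Nat.mul_le_mul_left _ (by nlinarith)

/-- **Mertens along the system, from above**: `Σ_{p ≤ x} ρ_f(p)/p ≤ k log log x + C` for `x ≥ 2`
(`Σ_p (k − ρ_f(p))/p` converges, `AZFG2020_tendsto_sum_sub_omega_div_holds`; Mertens `Σ_{p≤x} 1/p ≤ log log x + 4`).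
[folklore] -/
theorem exists_sum_rootCount_div_le (hf : IsBatemanHornSystem f) :
    ∃ C : ℝ, ∀ x : ℕ, 2 ≤ x →
      ∑ p ∈ Nat.primesLE x, (polyRootCountMod f p : ℝ) / p ≤ k * Real.log (Real.log x) + C := by
  obtain ⟨L, hL⟩ := AZFG2020_tendsto_sum_sub_omega_div_holds k f hf
  obtain ⟨m, hm⟩ := hL.bddBelow_range
  refine ⟨4 * k - m, fun x hx => ?_⟩
  have h1 : m ≤ ∑ p ∈ Nat.primesLE x, ((k : ℝ) - polyRootCountMod f p) / p := hm ⟨x, rfl⟩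
  have h2 := Literature.NumberTheory.LFunctions.MertensBound.sum_inv_prime_le x hx
  have h3 : ∑ p ∈ Nat.primesLE x, ((k : ℝ) - polyRootCountMod f p) / p =
      k * ∑ p ∈ Nat.primesLE x, (1 : ℝ) / p - ∑ p ∈ Nat.primesLE x, (polyRootCountMod f p : ℝ) / p := by
    rw [Finset.mul_sum, ← Finset.sum_sub_distrib]
    refine Finset.sum_congr rfl fun p _ => ?_
    ring
  rw [h3] at h1
  have hk : (0 : ℝ) ≤ k := Nat.cast_nonneg _
  nlinarith [mul_le_mul_of_nonneg_left h2 hk]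

/-- **Eventual positivity**: all `fᵢ(n) ≥ 2` for `n ≥ n₀`. [folklore] -/
theorem exists_forall_two_le_eval' (hf : IsBatemanHornSystem f) :
    ∃ n₀ : ℕ, ∀ n, n₀ ≤ n → ∀ i, (2 : ℤ) ≤ (f i).eval (n : ℤ) :=
  Summit.Parity.BatemanHorn.Theorems.AlmostPrimeZerosExtraction.exists_forall_two_le_eval hf

end System

/-! ### The `K`-capped statistic `s_K(m) = Σ_{p^v ∥ m} min(v, K)` -/

/-- `s_K(p^j) = min(j, K)`. [folklore] -/
theorem cappedK_prime_pow (K : ℕ) {p : ℕ} (hp : p.Prime) (j : ℕ) :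
    ((p ^ j).factorization.sum fun _ v => min v K) = min j K := by
  rw [hp.factorization_pow, Finsupp.sum_single_index]
  simp

/-- `s_K` is additive on coprime arguments. [folklore] -/
theorem cappedK_mul (K : ℕ) {m n : ℕ} (hm : m ≠ 0) (hn : n ≠ 0) (h : m.Coprime n) :
    ((m * n).factorization.sum fun _ v => min v K) =
      (m.factorization.sum fun _ v => min v K) + (n.factorization.sum fun _ v => min v K) := by
  rw [Nat.factorization_mul hm hn, Finsupp.sum_add_index_of_disjoint]
  simpa only [Nat.support_factorization] using h.disjoint_primeFactors

/-- `Σᵢ s(mᵢ) ≤ s_{2k}(∏ᵢ mᵢ)` for `mᵢ ≠ 0` (`s = ` cap `2`): termwise `Σᵢ min(v_p(mᵢ), 2) ≤ min(v_p(∏ mᵢ), 2k)`. [folklore] -/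
theorem sum_capped_le_cappedK {k : ℕ} (m : Fin k → ℕ) (hm : ∀ i, m i ≠ 0) :
    ∑ i, ((m i).factorization.sum fun _ v => min v 2) ≤ ((∏ i, m i).factorization.sum fun _ v => min v (2 * k)) := by
  classical
  set M := ∏ i, m i with hMdef
  have hM : M ≠ 0 := Finset.prod_ne_zero_iff.2 fun i _ => hm i
  have hfac : M.factorization = ∑ i, (m i).factorization := Nat.factorization_prod fun i _ => hm i
  have hsub : ∀ i, (m i).primeFactors ⊆ M.primeFactors := fun i =>
    Nat.primeFactors_mono (Finset.dvd_prod_of_mem _ (mem_univ i)) hM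
  have h1 : ∀ i, ((m i).factorization.sum fun _ v => min v 2) =
      ∑ p ∈ M.primeFactors, min ((m i).factorization p) 2 := by
    intro i
    rw [Finsupp.sum, Nat.support_factorization]
    refine Finset.sum_subset (hsub i) fun p _ hp => ?_
    rw [← Nat.support_factorization, Finsupp.notMem_support_iff] at hp
    rw [hp]; rfl
  have h2 : (M.factorization.sum fun _ v => min v (2 * k)) = ∑ p ∈ M.primeFactors, min (M.factorization p) (2 * k) := by
    rw [Finsupp.sum, Nat.support_factorization]
  rw [h2]
  simp_rw [h1]
  rw [Finset.sum_comm]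
  refine Finset.sum_le_sum fun p _ => ?_
  have hvp : M.factorization p = ∑ i, (m i).factorization p := by rw [hfac, Finsupp.finsetSum_apply]
  rw [hvp, le_min_iff]
  refine ⟨Finset.sum_le_sum fun i _ => min_le_left _ _, ?_⟩
  calc ∑ i, min ((m i).factorization p) 2 ≤ ∑ _i : Fin k, 2 := Finset.sum_le_sum fun i _ => min_le_right _ _
    _ = 2 * k := by simp [mul_comm]

/-- **Registered form** (`--supports stmt-Parity-11292`): Mertens along a Bateman–Horn system from above,
`Σ_{p ≤ x} ρ_f(p)/p ≤ k log log x + C`. [folklore] -/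
theorem systemRootCount_mertens_upper : ∀ (k : ℕ) (f : Fin k → ℤ[X]), IsBatemanHornSystem f → ∃ C : ℝ, ∀ x : ℕ, 2 ≤ x → ∑ p ∈ Nat.primesLE x, (polyRootCountMod f p : ℝ) / p ≤ k * Real.log (Real.log x) + C :=
  fun _k _f hf => exists_sum_rootCount_div_le hf

end

end Summit.Parity.BatemanHorn.Cruxes.SystemLSDRealSegment.BetaThinnedRootKernel.Nair
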